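import Literature.Analysis.TotalPositivity.PolyaFrequencyRealRooted
import Literature.Analysis.TotalPositivity.PolyaFrequencyLaguerrePolya
import Literature.Analysis.TotalPositivity.PolyaFrequencySufficiency
import Mathlib.Analysis.Fourier.RiemannLebesgueLemma
import Mathlib.Analysis.Complex.Convex
import Mathlib.Analysis.Normed.Ring.InfiniteSum
import Mathlib.Analysis.SpecialFunctions.Exponential
import HarnessLib

/-!
# Schoenberg's theorem: necessity, and the proof of `schoenberg1951_pf_laplace`
(Schoenberg 1951, step N5)

Trunk `Literature/Analysis/TotalPositivity`, nineteenth (and last) proofs file accompanying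
`PolyaFrequencyFunctions.lean`: the necessity half of Schoenberg's theorem and the discharge
`schoenberg1951_pf_laplace_holds` of the named fact `schoenberg1951_pf_laplace`.

For a Pólya frequency function `Λ` (decay `Λ ≤ C e^{−η|x|}`, PolyaFrequencyDecay.lean):

* the bilateral Laplace transform `F(s) = ∫ e^{−xs} Λ(x) dx` is analytic on the strip `|Re s| < η`
  with Taylor series `Σ_k c_k s^k/k!`, `c_k = ∫ (−t)^k Λ` (`hasSum_laplace_of_decay`, dominated
  convergence for series);
* with `d` the binomial inverse of `c` (PolyaFrequencyPolynomials.lean) the reversed Jensen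
  polynomials of `Ψ = Σ d_k s^k/k!` are real-rooted (PolyaFrequencyRealRooted.lean), so by the
  Pólya–Schur/Laguerre–Pólya theorem (PolyaFrequencyLaguerrePolya.lean) `Ψ` is entire of the form
  `Ψ(s) = C e^{−γs²+δs} ∏ (1 + δ_ν s) e^{−δ_ν s}`, `C = 1/∫Λ`, `γ ≥ 0`, `Σ δ_ν² < ∞`;
* `F · Ψ = 1` near `0` (Cauchy product and the inverse relation), hence on the whole strip
  (identity theorem), which is `HasLaplaceTransformInvOn Λ Ψ (−η) η`;
* `γ + Σ δ_ν² > 0`, for otherwise `|F(iy)| = ∫Λ` for all real `y`, contradicting the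
  Riemann–Lebesgue lemma.

Together with the sufficiency half (PolyaFrequencySufficiency.lean) this proves
`schoenberg1951_pf_laplace`. [Schoenberg1951, Thms. 1–2; SchoenbergWhitney1953, Introduction]

## References

* I. J. Schoenberg, *On Pólya frequency functions. I. The totally positive functions and their
  Laplace transforms*, J. Analyse Math. 1 (1951) 331–374. [Schoenberg1951]
* I. J. Schoenberg, A. Whitney, *On Pólya frequency functions. III*, Trans. AMS 74 (1953) 246–259,
  Introduction. [SchoenbergWhitney1953]
* S. Karlin, *Total Positivity* I (1968), Ch. 7. [Karlin1968]
-/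

noncomputable section

open MeasureTheory Filter Set Finset Complex Polynomial
open scoped Topology Polynomial

namespace Literature.Analysis.TotalPositivity

/-! ### The Laplace transform of an exponentially decaying function as a power series -/

/-- **Laplace transform as a power series.** If `‖g(x)‖ ≤ C e^{−η|x|}` then for `‖w‖ < η`
`∫ e^{−xw} g(x) dx = Σ_k (∫ (−x)^k g(x) dx / k!) w^k` (dominated convergence for series).
[folklore] -/
theorem hasSum_laplace_of_decay {g : ℝ → ℂ} (hg : AEStronglyMeasurable g) {C η : ℝ}
    (hbound : ∀ x, ‖g x‖ ≤ C * Real.exp (-(η * |x|))) {w : ℂ} (hw : ‖w‖ < η) :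
    HasSum (fun k => (∫ x : ℝ, (-(x : ℂ)) ^ k * g x) / (k.factorial : ℂ) * w ^ k)
      (∫ x : ℝ, cexp (-(x : ℂ) * w) * g x) := by
  have hC : 0 ≤ C := by
    have := (norm_nonneg _).trans (hbound 0)
    simpa using this
  set F : ℕ → ℝ → ℂ := fun k x => (-(x : ℂ) * w) ^ k / (k.factorial : ℂ) * g x with hF
  set bound : ℕ → ℝ → ℝ := fun k x =>
    (‖w‖ * |x|) ^ k / (k.factorial : ℝ) * (C * Real.exp (-(η * |x|))) with hbd
  have hF_meas : ∀ k, AEStronglyMeasurable (F k) := by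
    intro k
    exact (Continuous.aestronglyMeasurable (by fun_prop)).mul hg
  have h_bound : ∀ k, ∀ᵐ x : ℝ, ‖F k x‖ ≤ bound k x := by
    intro k
    refine Eventually.of_forall fun x => ?_
    simp only [hF, hbd]
    rw [norm_mul, norm_div, norm_pow, norm_mul, norm_neg, Complex.norm_real, Real.norm_eq_abs,
      Complex.norm_natCast, mul_comm |x| ‖w‖]
    exact mul_le_mul_of_nonneg_left (hbound x) (by positivity)
  have hbound_sum : ∀ x, HasSum (fun k => bound k x)
      (Real.exp (‖w‖ * |x|) * (C * Real.exp (-(η * |x|)))) := by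
    intro x
    have h1 := NormedSpace.expSeries_div_hasSum_exp (‖w‖ * |x|)
    rw [← Real.exp_eq_exp_ℝ] at h1
    exact h1.mul_right _
  have bound_summable : ∀ᵐ x : ℝ, Summable fun k => bound k x :=
    Eventually.of_forall fun x => (hbound_sum x).summable
  have bound_integrable : Integrable (fun x => ∑' k, bound k x) := by
    have heq : (fun x => ∑' k, bound k x) = fun x => C * Real.exp (-((η - ‖w‖) * |x|)) := by
      funext x
      rw [(hbound_sum x).tsum_eq, mul_left_comm, ← Real.exp_add]
      congr 2
      ring
    rw [heq]
    exact (integrable_exp_neg_mul_abs (by linarith)).const_mul C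
  have h_lim : ∀ᵐ x : ℝ, HasSum (fun k => F k x) (cexp (-(x : ℂ) * w) * g x) := by
    refine Eventually.of_forall fun x => ?_
    have h1 := NormedSpace.expSeries_div_hasSum_exp (-(x : ℂ) * w)
    rw [← Complex.exp_eq_exp_ℂ] at h1
    exact h1.mul_right _
  have h := hasSum_integral_of_dominated_convergence bound hF_meas h_bound bound_summable
    bound_integrable h_lim
  refine (h.congr_fun ?_ : _)
  intro k
  simp only [hF]
  have hk : (∫ x : ℝ, (-(x : ℂ) * w) ^ k / (k.factorial : ℂ) * g x) =
      (w ^ k / (k.factorial : ℂ)) * ∫ x : ℝ, (-(x : ℂ)) ^ k * g x := by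
    rw [← integral_const_mul]
    refine integral_congr_ae (Eventually.of_forall fun x => ?_)
    simp only [mul_pow]
    ring
  rw [hk]
  ring

/-- The Laplace integrand of a decaying function is integrable on the strip. [folklore] -/
theorem integrable_laplace_of_decay {Λ : ℝ → ℝ} (hΛ : Measurable Λ) (hΛ0 : ∀ x, 0 ≤ Λ x)
    {C η : ℝ} (hdec : ∀ x, Λ x ≤ C * Real.exp (-(η * |x|))) {s : ℂ} (hs : |s.re| < η) :
    Integrable (fun x : ℝ => cexp (-(x : ℂ) * s) * (Λ x : ℂ)) := by
  have hC : 0 ≤ C := by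
    have := (hΛ0 0).trans (hdec 0)
    simpa using this
  refine ((integrable_exp_neg_mul_abs (by linarith : 0 < η - |s.re|)).const_mul C).mono' ?_ ?_
  · exact (Continuous.aestronglyMeasurable (by fun_prop)).mul
      (Complex.measurable_ofReal.comp hΛ).aestronglyMeasurable
  · refine Eventually.of_forall fun x => ?_
    rw [norm_mul, Complex.norm_exp, Complex.norm_real, Real.norm_eq_abs, abs_of_nonneg (hΛ0 x)]
    have hre : (-(x : ℂ) * s).re = -(x * s.re) := by simp
    rw [hre]
    have h1 : -(x * s.re) ≤ |s.re| * |x| := by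
      rw [mul_comm |s.re|]
      have := neg_abs_le (x * s.re)
      rw [abs_mul] at this
      linarith
    calc Real.exp (-(x * s.re)) * Λ x ≤ Real.exp (|s.re| * |x|) * (C * Real.exp (-(η * |x|))) :=
          mul_le_mul (Real.exp_le_exp.2 h1) (hdec x) (hΛ0 x) (Real.exp_pos _).le
      _ = C * Real.exp (-((η - |s.re|) * |x|)) := by
          rw [mul_left_comm, ← Real.exp_add]
          congr 2
          ring

/-- **The Laplace transform is analytic on the strip.** [folklore] -/
theorem analyticOnNhd_laplace_of_decay {Λ : ℝ → ℝ} (hΛ : Measurable Λ) (hΛ0 : ∀ x, 0 ≤ Λ x)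
    {C η : ℝ} (hdec : ∀ x, Λ x ≤ C * Real.exp (-(η * |x|))) :
    AnalyticOnNhd ℂ (fun s => ∫ x : ℝ, cexp (-(x : ℂ) * s) * (Λ x : ℂ)) {s : ℂ | |s.re| < η} := by
  intro s₀ hs₀
  simp only [Set.mem_setOf_eq] at hs₀
  set ρ : ℝ := η - |s₀.re| with hρ
  have hρ0 : 0 < ρ := by simp only [hρ]; linarith
  set g : ℝ → ℂ := fun x => cexp (-(x : ℂ) * s₀) * (Λ x : ℂ) with hg
  have hgm : AEStronglyMeasurable g :=
    (Continuous.aestronglyMeasurable (by fun_prop)).mul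
      (Complex.measurable_ofReal.comp hΛ).aestronglyMeasurable
  have hgb : ∀ x, ‖g x‖ ≤ C * Real.exp (-(ρ * |x|)) := by
    intro x
    simp only [hg]
    rw [norm_mul, Complex.norm_exp, Complex.norm_real, Real.norm_eq_abs, abs_of_nonneg (hΛ0 x)]
    have hre : (-(x : ℂ) * s₀).re = -(x * s₀.re) := by simp
    rw [hre]
    have h1 : -(x * s₀.re) ≤ |s₀.re| * |x| := by
      rw [mul_comm |s₀.re|]
      have := neg_abs_le (x * s₀.re)
      rw [abs_mul] at this
      linarith
    calc Real.exp (-(x * s₀.re)) * Λ x ≤ Real.exp (|s₀.re| * |x|) * (C * Real.exp (-(η * |x|))) :=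
          mul_le_mul (Real.exp_le_exp.2 h1) (hdec x) (hΛ0 x) (Real.exp_pos _).le
      _ = C * Real.exp (-(ρ * |x|)) := by
          rw [mul_left_comm, ← Real.exp_add]
          congr 2
          simp only [hρ]
          ring
  -- the power series of `w ↦ F(s₀ + w)` at `0`
  have hser : ∀ w : ℂ, ‖w‖ < ρ → HasSum
      (fun k => (∫ x : ℝ, (-(x : ℂ)) ^ k * g x) / (k.factorial : ℂ) * w ^ k)
      ((fun w => ∫ x : ℝ, cexp (-(x : ℂ) * (s₀ + w)) * (Λ x : ℂ)) w) := by
    intro w hw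
    have h := hasSum_laplace_of_decay hgm hgb hw
    have heq : (∫ x : ℝ, cexp (-(x : ℂ) * w) * g x) =
        ∫ x : ℝ, cexp (-(x : ℂ) * (s₀ + w)) * (Λ x : ℂ) := by
      refine integral_congr_ae (Eventually.of_forall fun x => ?_)
      simp only [hg]
      rw [← mul_assoc, ← Complex.exp_add]
      congr 2
      ring
    rw [heq] at h
    exact h
  have hps := hasFPowerSeriesOnBall_of_hasSum hρ0 hser
  have han : AnalyticAt ℂ (fun w => ∫ x : ℝ, cexp (-(x : ℂ) * (s₀ + w)) * (Λ x : ℂ)) 0 :=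
    hps.analyticAt
  have hcomp := han.comp_of_eq (analyticAt_id.sub analyticAt_const) (sub_self s₀)
  refine hcomp.congr (Eventually.of_forall fun s => ?_)
  simp

/-! ### `F · Ψ = 1` near the origin -/

/-- **The Cauchy product.** With `c_k = ∫(−t)^kΛ`, `d` the binomial inverse of `c` and
`Ψ(z) = Σ d_k z^k/k!` (convergent everywhere), `(∫ e^{−xs}Λ) · Ψ(s) = 1` for `‖s‖ < η`.
[cite: Schoenberg1951, §§8–9] -/
theorem laplace_mul_eq_one {Λ : ℝ → ℝ} (hΛ : Measurable Λ) (hΛ0 : ∀ x, 0 ≤ Λ x)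
    {C η : ℝ} (hη : 0 < η) (hdec : ∀ x, Λ x ≤ C * Real.exp (-(η * |x|)))
    {c d : ℕ → ℝ} (hc : ∀ k, c k = ∫ t, (-t) ^ k * Λ t)
    (hd : ∀ k, ∑ p ∈ Finset.antidiagonal k, ((k.choose p.1 : ℕ) : ℝ) * c p.1 * d p.2 =
      if k = 0 then 1 else 0)
    {Ψ : ℂ → ℂ} (hΨ : ∀ z, HasSum (fun k => ((d k / k.factorial : ℝ) : ℂ) * z ^ k) (Ψ z))
    {s : ℂ} (hs : ‖s‖ < η) :
    (∫ x : ℝ, cexp (-(x : ℂ) * s) * (Λ x : ℂ)) * Ψ s = 1 := by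
  have hgm : AEStronglyMeasurable (fun x : ℝ => (Λ x : ℂ)) :=
    (Complex.measurable_ofReal.comp hΛ).aestronglyMeasurable
  have hgb : ∀ x, ‖(Λ x : ℂ)‖ ≤ C * Real.exp (-(η * |x|)) := by
    intro x
    rw [Complex.norm_real, Real.norm_eq_abs, abs_of_nonneg (hΛ0 x)]
    exact hdec x
  -- the series of `F`
  have hFser : ∀ w : ℂ, ‖w‖ < η →
      HasSum (fun k => ((c k / k.factorial : ℝ) : ℂ) * w ^ k)
        (∫ x : ℝ, cexp (-(x : ℂ) * w) * (Λ x : ℂ)) := by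
    intro w hw
    have h := hasSum_laplace_of_decay hgm hgb hw
    refine (h.congr_fun fun k => ?_ : _)
    have hint : (∫ x : ℝ, (-(x : ℂ)) ^ k * (Λ x : ℂ)) = ((c k : ℝ) : ℂ) := by
      rw [hc k, ← integral_complex_ofReal]
      refine integral_congr_ae (Eventually.of_forall fun x => ?_)
      push_cast
      ring
    rw [hint]
    push_cast
    ring
  have hF := hFser s hs
  have hFn : Summable fun k => ‖((c k / k.factorial : ℝ) : ℂ) * s ^ k‖ :=
    summable_norm_of_hasSum (h := fun w => ∫ x : ℝ, cexp (-(x : ℂ) * w) * (Λ x : ℂ)) hη hFser hs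
  have hΨn : Summable fun k => ‖((d k / k.factorial : ℝ) : ℂ) * s ^ k‖ :=
    summable_norm_of_hasSum (by linarith [norm_nonneg s] : 0 < ‖s‖ + 1) (fun z _ => hΨ z)
      (by linarith)
  rw [← hF.tsum_eq, ← (hΨ s).tsum_eq, tsum_mul_tsum_eq_tsum_sum_antidiagonal_of_summable_norm hFn hΨn]
  have hinner : ∀ m, ∑ p ∈ Finset.antidiagonal m,
      ((c p.1 / p.1.factorial : ℝ) : ℂ) * s ^ p.1 * (((d p.2 / p.2.factorial : ℝ) : ℂ) * s ^ p.2) =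
        if m = 0 then 1 else 0 := by
    intro m
    have h1 : ∀ p ∈ Finset.antidiagonal m,
        ((c p.1 / p.1.factorial : ℝ) : ℂ) * s ^ p.1 * (((d p.2 / p.2.factorial : ℝ) : ℂ) * s ^ p.2) =
          ((((m.choose p.1 : ℕ) : ℝ) * c p.1 * d p.2 / m.factorial : ℝ) : ℂ) * s ^ m := by
      intro p hp
      have hpm : p.1 + p.2 = m := Finset.mem_antidiagonal.1 hp
      have hch : ((m.choose p.1 : ℕ) : ℝ) * p.1.factorial * p.2.factorial = m.factorial := by
        rw [← hpm, Nat.choose_symm_add]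
        exact_mod_cast Nat.add_choose_mul_factorial_mul_factorial p.1 p.2
      have hchn : ((m.choose p.1 : ℕ) : ℝ) ≠ 0 := by
        exact_mod_cast (Nat.choose_pos (by omega : p.1 ≤ m)).ne'
      have hf1 : (p.1.factorial : ℝ) ≠ 0 := by exact_mod_cast p.1.factorial_ne_zero
      have hf2 : (p.2.factorial : ℝ) ≠ 0 := by exact_mod_cast p.2.factorial_ne_zero
      have hfm : (m.factorial : ℝ) ≠ 0 := by exact_mod_cast m.factorial_ne_zero
      have hcoef : c p.1 / p.1.factorial * (d p.2 / p.2.factorial) =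
          ((m.choose p.1 : ℕ) : ℝ) * c p.1 * d p.2 / m.factorial := by
        rw [← hch]
        field_simp
      rw [← hpm, pow_add]
      push_cast
      rw [hpm]
      have hcoef' := congrArg (fun r : ℝ => (r : ℂ)) hcoef
      push_cast at hcoef'
      linear_combination (s ^ p.1 * s ^ p.2) * hcoef'
    rw [Finset.sum_congr rfl h1, ← Finset.sum_mul]
    have h2 : ∑ p ∈ Finset.antidiagonal m,
        ((((m.choose p.1 : ℕ) : ℝ) * c p.1 * d p.2 / m.factorial : ℝ) : ℂ) =
          (((if m = 0 then 1 else 0 : ℝ) / m.factorial : ℝ) : ℂ) := by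
      rw [← Complex.ofReal_sum, ← Finset.sum_div, hd m]
    rw [h2]
    split_ifs with hm
    · subst hm
      simp
    · simp
  simp only [hinner]
  exact tsum_ite_eq 0 (fun _ => (1 : ℂ))

/-! ### Necessity -/

/-- **Schoenberg's theorem, necessity half**: the bilateral Laplace transform of a Pólya frequency
function converges in a strip `−η < Re s < η` and equals there `1/Ψ(s)` with `Ψ` of Schoenberg's
form (7). [cite: Schoenberg1951, Thm. 1] [cite: SchoenbergWhitney1953, Introduction (5)–(7)] -/
theorem schoenberg1951_pf_laplace_mp (Λ : ℝ → ℝ) (h : IsPolyaFrequencyFun Λ) :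
    ∃ (Ψ : ℂ → ℂ) (a b : ℝ), a < 0 ∧ 0 < b ∧ HasSchoenbergForm Ψ ∧
      HasLaplaceTransformInvOn Λ Ψ a b := by
  classical
  obtain ⟨η, hη, C, hC0, hdec⟩ := h.exists_exp_decay
  -- the moments and their binomial inverse
  set c : ℕ → ℝ := fun k => ∫ t, (-t) ^ k * Λ t with hc
  have hc0 : c 0 = ∫ t, Λ t := by simp [hc]
  have hc0pos : 0 < c 0 := by rw [hc0]; exact h.integral_pos
  obtain ⟨d, -, hd⟩ := exists_binomial_inverse hc0pos.ne'
  have hcd0 : c 0 * d 0 = 1 := inverse_zero_mul hd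
  have hd0pos : 0 < d 0 := by
    by_contra hle
    rw [not_lt] at hle
    nlinarith
  -- the normalised coefficients and the real-rootedness of the reversed Jensen polynomials
  set γ : ℕ → ℝ := fun k => c 0 * d k with hγ
  have hγ0 : γ 0 = 1 := by simp [hγ, hcd0]
  have hreal : ∀ n, Multiset.card
      (∑ k ∈ Finset.range (n + 1), γ k • hasseDeriv k (X ^ n : ℝ[X])).roots = n := by
    intro n
    have h1 := (h.card_roots_inverseTransform_X_pow (c := c) (fun k => rfl) hd n).2
    have heq : ∑ k ∈ Finset.range (n + 1), γ k • hasseDeriv k (X ^ n : ℝ[X]) =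
        c 0 • ∑ k ∈ Finset.range (n + 1), d k • hasseDeriv k (X ^ n : ℝ[X]) := by
      rw [Finset.smul_sum]
      refine Finset.sum_congr rfl fun k _ => ?_
      rw [smul_smul]
    rw [heq, Polynomial.roots_smul_nonzero _ hc0pos.ne']
    exact h1
  -- Laguerre–Pólya
  obtain ⟨κ, δ, hκ, hδ, hG⟩ := exists_hasSum_of_realRooted hγ0 hreal
  set Ψ : ℂ → ℂ := fun z => (d 0 : ℂ) * (cexp ((γ 1 : ℂ) * z - (κ : ℂ) * z ^ 2 / 2) *
    ∏' i, (1 + (δ i : ℂ) * z) * cexp (-((δ i : ℂ) * z))) with hΨ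
  have hΨsum : ∀ z, HasSum (fun k => ((d k / k.factorial : ℝ) : ℂ) * z ^ k) (Ψ z) := by
    intro z
    have h1 := (hG z).mul_left (d 0 : ℂ)
    refine (h1.congr_fun fun k => ?_ : _)
    simp only [hγ]
    push_cast
    have : (d 0 : ℂ) * (c 0 : ℂ) = 1 := by rw [mul_comm]; exact_mod_cast hcd0
    linear_combination (-((d k : ℂ) / (k.factorial : ℂ) * z ^ k)) * this
  -- the Laplace transform and the identity `F Ψ = 1` on the strip
  set F : ℂ → ℂ := fun s => ∫ x : ℝ, cexp (-(x : ℂ) * s) * (Λ x : ℂ) with hF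
  set U : Set ℂ := {s : ℂ | |s.re| < η} with hU
  have hFan : AnalyticOnNhd ℂ F U := analyticOnNhd_laplace_of_decay h.measurable h.nonneg hdec
  have hΨan : AnalyticOnNhd ℂ Ψ Set.univ := by
    intro z _
    have hps := hasFPowerSeriesOnBall_of_hasSum (by linarith [norm_nonneg z] : 0 < ‖z‖ + 1)
      (fun w _ => hΨsum w)
    refine hps.analyticAt_of_mem ?_
    rw [Metric.mem_eball, edist_zero_right, ← ofReal_norm, ENNReal.ofReal_lt_ofReal_iff (by
      linarith [norm_nonneg z])]
    linarith
  have hUpre : IsPreconnected U := by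
    have hUeq : U = {s : ℂ | -η < s.re} ∩ {s : ℂ | s.re < η} := by
      ext s
      simp [hU, abs_lt]
    rw [hUeq]
    exact ((convex_halfSpace_re_gt (-η)).inter (convex_halfSpace_re_lt η)).isPreconnected
  have h0U : (0 : ℂ) ∈ U := by simp [hU, hη]
  have hev : (fun s => F s * Ψ s - 1) =ᶠ[𝓝 (0 : ℂ)] 0 := by
    have hball : Metric.ball (0 : ℂ) η ∈ 𝓝 (0 : ℂ) := Metric.ball_mem_nhds _ hη
    filter_upwards [hball] with s hs
    have hs' : ‖s‖ < η := by simpa using hs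
    simp only [Pi.zero_apply, sub_eq_zero]
    exact laplace_mul_eq_one h.measurable h.nonneg hη hdec (fun k => rfl) hd hΨsum hs'
  have hEq : EqOn (fun s => F s * Ψ s - 1) 0 U :=
    ((hFan.mul (hΨan.mono (Set.subset_univ U))).sub analyticOnNhd_const)
      |>.eqOn_zero_of_preconnected_of_eventuallyEq_zero hUpre h0U hev
  have hFΨ : ∀ s : ℂ, |s.re| < η → F s * Ψ s = 1 := by
    intro s hs
    have := hEq (show s ∈ U from hs)
    simpa [sub_eq_zero] using this
  -- the Laplace transform statement
  have hL : HasLaplaceTransformInvOn Λ Ψ (-η) η := by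
    intro s hs1 hs2
    have hs : |s.re| < η := abs_lt.2 ⟨hs1, hs2⟩
    have h1 := hFΨ s hs
    have hΨ0 : Ψ s ≠ 0 := by
      intro h0
      rw [h0, mul_zero] at h1
      exact zero_ne_one h1
    exact ⟨integrable_laplace_of_decay h.measurable h.nonneg hdec hs, hΨ0,
      eq_one_div_of_mul_eq_one_left h1⟩
  -- positivity of `γ + Σ δ²` by the Riemann–Lebesgue lemma
  have hpos : 0 < κ / 2 + ∑' i, δ i ^ 2 := by
    by_contra hle
    rw [not_lt] at hle
    have hT0 : 0 ≤ ∑' i, δ i ^ 2 := tsum_nonneg fun i => sq_nonneg (δ i)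
    have hκ0 : κ = 0 := by linarith
    have hδ0 : ∀ i, δ i = 0 := by
      intro i
      have h1 : δ i ^ 2 ≤ ∑' j, δ j ^ 2 := hδ.le_tsum i (fun j _ => sq_nonneg (δ j))
      nlinarith [sq_nonneg (δ i)]
    have hΨexp : ∀ s, Ψ s = (d 0 : ℂ) * cexp ((γ 1 : ℂ) * s) := by
      intro s
      simp only [hΨ, hδ0, hκ0, Complex.ofReal_zero, zero_mul, neg_zero, Complex.exp_zero,
        add_zero, mul_one, tprod_one, zero_div, sub_zero]
    -- `‖F(iy)‖ = c 0` on the imaginary axis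
    have hnormF : ∀ w : ℝ, ‖∫ v : ℝ, Real.fourierChar (-(v * w)) • (Λ v : ℂ)‖ = c 0 := by
      intro w
      set s : ℂ := ((2 * Real.pi * w : ℝ) : ℂ) * I with hs
      have hsre : s.re = 0 := by simp [hs]
      have hint : (∫ v : ℝ, Real.fourierChar (-(v * w)) • (Λ v : ℂ)) = F s := by
        simp only [hF]
        refine integral_congr_ae (Eventually.of_forall fun v => ?_)
        simp only [Circle.smul_def, Real.fourierChar_apply, smul_eq_mul, hs]
        congr 1
        congr 1
        push_cast
        ring
      have h1 := hFΨ s (by rw [hsre, abs_zero]; exact hη)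
      rw [hΨexp] at h1
      have hF' : F s = (c 0 : ℂ) * cexp (-((γ 1 : ℂ) * s)) := by
        have h2 : (d 0 : ℂ) * (c 0 : ℂ) = 1 := by rw [mul_comm]; exact_mod_cast hcd0
        have h3 : cexp ((γ 1 : ℂ) * s) * cexp (-((γ 1 : ℂ) * s)) = 1 := by
          rw [← Complex.exp_add, add_neg_cancel, Complex.exp_zero]
        calc F s = F s * ((d 0 : ℂ) * cexp ((γ 1 : ℂ) * s)) * ((c 0 : ℂ) * cexp (-((γ 1 : ℂ) * s))) := by
              rw [mul_assoc, show (d 0 : ℂ) * cexp ((γ 1 : ℂ) * s) * ((c 0 : ℂ) * cexp (-((γ 1 : ℂ) * s)))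
                = ((d 0 : ℂ) * (c 0 : ℂ)) * (cexp ((γ 1 : ℂ) * s) * cexp (-((γ 1 : ℂ) * s))) by ring,
                h2, h3, mul_one, mul_one]
          _ = (c 0 : ℂ) * cexp (-((γ 1 : ℂ) * s)) := by rw [h1, one_mul]
      rw [hint, hF', norm_mul, Complex.norm_real, Real.norm_eq_abs, abs_of_pos hc0pos]
      have : -((γ 1 : ℂ) * s) = ((-(γ 1 * (2 * Real.pi * w)) : ℝ) : ℂ) * I := by
        simp only [hs]
        push_cast
        ring
      rw [this, Complex.norm_exp_ofReal_mul_I, mul_one]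
    have hRL := Real.tendsto_integral_exp_smul_cocompact (fun v : ℝ => (Λ v : ℂ))
    have hev' : ∀ᶠ w : ℝ in cocompact ℝ, ‖∫ v : ℝ, Real.fourierChar (-(v * w)) • (Λ v : ℂ)‖ < c 0 :=
      (tendsto_zero_iff_norm_tendsto_zero.1 hRL).eventually (gt_mem_nhds hc0pos)
    obtain ⟨w, hw⟩ := hev'.exists
    rw [hnormF w] at hw
    exact lt_irrefl _ hw
  -- the Schoenberg form
  have hform : HasSchoenbergForm Ψ := by
    refine ⟨d 0, κ / 2, γ 1, δ, hd0pos, by positivity, hδ, hpos, fun s => ?_⟩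
    simp only [hΨ]
    rw [mul_assoc]
    congr 2
    congr 1
    push_cast
    ring
  exact ⟨Ψ, -η, η, by linarith, hη, hform, hL⟩

/-! ### The named fact -/

/-- **Schoenberg 1951** — Pólya frequency functions are exactly the reciprocal bilateral Laplace
transforms, on a strip about the imaginary axis, of the Laguerre–Pólya functions
`Ψ(s) = C e^{−γs²+δs} ∏ (1 + δ_ν s) e^{−δ_ν s}` (`C > 0`, `γ ≥ 0`, `0 < γ + Σ δ_ν² < ∞`): the
discharge of the named fact `schoenberg1951_pf_laplace`.
[cite: Schoenberg1951, Thms. 1–2] [cite: SchoenbergWhitney1953, Introduction] -/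
theorem schoenberg1951_pf_laplace_holds : schoenberg1951_pf_laplace :=
  ⟨schoenberg1951_pf_laplace_mp, schoenberg1951_pf_laplace_mpr⟩

end Literature.Analysis.TotalPositivity
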